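import Literature.Analysis.FluidPDE.PressureHarmonicPartL3
import HarnessLib

/-!
# Pressure normalisation for classical solutions with `L³` slices (Tao's Lemma 4.1 (i) in `L³`)

Analysis/FluidPDE proofs file (theorems only), second half of the `L³` twin of Tao's
pressure-normalisation lemma (T. Tao, Anal. PDE 6 (2013) = arXiv:1108.1165, Lemma 4.1 (i):
"for almost every `t`, `p = −Δ⁻¹∂ᵢ∂ⱼ(uᵢuⱼ) + C(t)`"; finite-energy version:
`NormalisedPressureDischarge.lean`), on the discharge path of
`Literature.Analysis.FluidPDE.chaeWolf2017_dss_typeI_decay` (Chae–Wolf 2017, Thm. 1.1).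

**Main result** (`pressure_ae_eq_rieszPressure_add_const`). Let `(u, p)` be a classical solution
of the unforced Navier–Stokes system (`ν ≥ 0`) on an open time interval `(t₁, t₂)` whose slices
lie in `L³(ℝ³)` with `sup_t ‖u(t)‖_{L³} < ∞`. Then for every `t ∈ (t₁, t₂)` there is a constant
`C(t)` with `p(t, x) = Π[u(t)](x) + C(t)` for a.e. `x`, `Π` the Riesz pressure
(`rieszPressure`). In particular the pressure gradient of such a solution is that of the
Calderón–Zygmund pressure `RᵢRⱼ(uᵢuⱼ) ∈ L^{3/2}` — the normalisation implicit in Chae–Wolf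
2017, (2.4b), and in every use of `u ∈ C_t L³` classical solutions as mild / suitable solutions.

**Proof** (Tao's, run on the mollified harmonic part; `PressureHarmonicPartL3.lean` for the
identity). With `g(t) = p(t) − Π[u(t)]` and a normed bump `θ` of radius `≤ 1`, `θ ⋆ g(t)` is
harmonic and its derivative at `x₀` is, for every `R ≥ 1`,
`∂ₐ(θ ⋆ g(t))(x₀) = νA + B − W' − D` (probe identity), where by Hölder on the ball
`B(x₀, 2R+1)` against `‖u(t)‖_{L³} ≤ M` (in the AM–GM forms `‖u‖ ≤ (R²‖u‖³ + 2R⁻¹)/3`,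
`‖u‖² ≤ (2R‖u‖³ + R⁻²)/3`, and `∫_B |Π| ≤ |B|^{1/3}‖Π‖_{3/2}`) each of `A`, `B`, `D` and the
boundary term `W = ∫⟪u(t), Ψ⟫` is `O(R⁻¹)` uniformly in `t`; `W' = dW/dt`. The real-variable
uniqueness lemma of `HarmonicProbe` (`∫_{s₁}^{s₂} ∂ₐ(θ ⋆ g) dt = O(R⁻¹)` for all `R`) gives
`∇(θ ⋆ g(t)) = 0`, so every mollification of `g(t)` is constant, and `g(t)` is a.e. constant by
Lebesgue differentiation (`ConvolutionLaplacian.ae_eq_const_of_forall_convolution_normed_const`).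

## Mathlib / tree search

Tree: `PressureNormalisationL3.fderiv_mollified_harmonicPart_eq` and the `probeConv` bounds
(`PressureHarmonicPartL3`), `eq_zero_of_approx_antiderivative`, `exists_bound_baseBump_derivs`,
`baseBumpMass_pos` (`HarmonicProbe`), `hasDerivAt_integral_of_support_subset`,
`continuousOn_integral_of_support_subset` (`SpaceTimeCalculus`), `eLpNorm_rieszPressure_le`,
`steinConstThreeHalves` (`RieszPressureL3`). Mathlib: `eLpNorm_le_eLpNorm_mul_rpow_measure_univ`
(Hölder on a finite-measure set), `MemLp.eLpNorm_eq_integral_rpow_norm`,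
`Measure.addHaar_real_closedBall'`, `is_const_of_fderiv_eq_zero`.

## References

* T. Tao, *Localisation and compactness properties of the Navier–Stokes global regularity
  problem*, Anal. PDE 6 (2013) 25–107 = arXiv:1108.1165, §4, Lemma 4.1 (i) and its proof.
  [Tao2011]
* D. Chae, J. Wolf, Comm. PDE 42 (2017) = arXiv:1610.09464, §2, (2.4b) (arXiv p. 5).
  [ChaeWolf2017RemovingDSS]
-/

noncomputable section

open MeasureTheory Set Filter Metric Function ContinuousLinearMap
open scoped Topology Laplacian ContDiff Convolution InnerProductSpace RealInnerProductSpace ENNReal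
  NNReal

namespace Literature.Analysis.FluidPDE

namespace PressureNormalisationL3

/-- `1 ≤ 3/2` in `ℝ≥0∞`. [folklore] -/
private theorem one_le_three_halves : (1 : ℝ≥0∞) ≤ 3 / 2 :=
  ((ENNReal.lt_div_iff_mul_lt (Or.inl (by norm_num)) (Or.inl (by norm_num))).2 (by norm_num)).le

/-! ### Elementary inequalities (AM–GM) and conversions from `L³` bounds -/

/-- AM–GM in the form `x ≤ (s²x³ + 2s⁻¹)/3` (`x ≥ 0`, `s > 0`): `(sx − 1)²(sx + 2) ≥ 0`. [folklore] -/
private theorem le_amgm_one {x s : ℝ} (hx : 0 ≤ x) (hs : 0 < s) : x ≤ (s ^ 2 * x ^ 3 + 2 * s⁻¹) / 3 := by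
  have hs0 : s ≠ 0 := hs.ne'
  have key : 0 ≤ (s * x - 1) ^ 2 * (s * x + 2) := mul_nonneg (sq_nonneg _) (by positivity)
  have key' : 0 ≤ s⁻¹ * ((s * x - 1) ^ 2 * (s * x + 2)) := mul_nonneg (inv_nonneg.2 hs.le) key
  have e : s⁻¹ * ((s * x - 1) ^ 2 * (s * x + 2)) = s ^ 2 * x ^ 3 - 3 * x + 2 * s⁻¹ := by
    field_simp
    ring
  rw [e] at key'
  linarith

/-- AM–GM in the form `x² ≤ (2sx³ + s⁻²)/3` (`x ≥ 0`, `s > 0`): `(sx − 1)²(2sx + 1) ≥ 0`. [folklore] -/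
private theorem sq_le_amgm_two {x s : ℝ} (hx : 0 ≤ x) (hs : 0 < s) :
    x ^ 2 ≤ (2 * s * x ^ 3 + s⁻¹ ^ 2) / 3 := by
  have hs0 : s ≠ 0 := hs.ne'
  have key : 0 ≤ (s * x - 1) ^ 2 * (2 * s * x + 1) := mul_nonneg (sq_nonneg _) (by positivity)
  have key' : 0 ≤ s⁻¹ ^ 2 * ((s * x - 1) ^ 2 * (2 * s * x + 1)) := mul_nonneg (by positivity) key
  have e : s⁻¹ ^ 2 * ((s * x - 1) ^ 2 * (2 * s * x + 1)) = 2 * s * x ^ 3 - 3 * x ^ 2 + s⁻¹ ^ 2 := by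
    field_simp
    ring
  rw [e] at key'
  linarith

/-- From `‖v‖_{L³} ≤ M` to `∫ ‖v‖³ ≤ M³`. [folklore] -/
theorem integral_norm_pow_three_le {v : (EuclideanSpace ℝ (Fin 3)) → (EuclideanSpace ℝ (Fin 3))} (hv : MemLp v 3 volume) {M : ℝ≥0}
    (hM : eLpNorm v 3 volume ≤ M) : ∫ y, ‖v y‖ ^ 3 ≤ (M : ℝ) ^ 3 := by
  have h := hv.eLpNorm_eq_integral_rpow_norm (by norm_num) (by norm_num)
  have h3 : (3 : ℝ≥0∞).toReal = 3 := by norm_num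
  rw [h3] at h
  have e : ∀ y, ‖v y‖ ^ (3 : ℝ) = ‖v y‖ ^ 3 := fun y => by
    exact_mod_cast Real.rpow_natCast ‖v y‖ 3
  simp_rw [e] at h
  set I : ℝ := ∫ y, ‖v y‖ ^ 3 with hI
  have hI0 : 0 ≤ I := integral_nonneg fun y => by positivity
  rw [h] at hM
  have h1 : I ^ (3 : ℝ)⁻¹ ≤ (M : ℝ) := by
    have := (ENNReal.ofReal_le_iff_le_toReal ENNReal.coe_ne_top).1 hM
    simpa using this
  have h2 : (I ^ (3 : ℝ)⁻¹) ^ 3 = I := by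
    have := Real.rpow_inv_natCast_pow hI0 (n := 3) three_ne_zero
    exact_mod_cast this
  calc I = (I ^ (3 : ℝ)⁻¹) ^ 3 := h2.symm
    _ ≤ (M : ℝ) ^ 3 := pow_le_pow_left₀ (Real.rpow_nonneg hI0 _) h1 3

/-- From `‖v‖_{L³} ≤ M` to `‖Π[v]‖_{L^{3/2}} ≤ C_{3/2} M²` (real form). [cite: Stein1971, Ch. II §4.2 Thm. 3] -/
theorem toReal_eLpNorm_rieszPressure_le {v : (EuclideanSpace ℝ (Fin 3)) → (EuclideanSpace ℝ (Fin 3))} (hv : MemLp v 3 volume) {M : ℝ≥0}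
    (hM : eLpNorm v 3 volume ≤ M) :
    (eLpNorm (rieszPressure v) (3 / 2 : ℝ≥0∞) volume).toReal ≤ steinConstThreeHalves * (M : ℝ) ^ 2 := by
  have h1 : eLpNorm (rieszPressure v) (3 / 2 : ℝ≥0∞) volume ≤ steinConstThreeHalves * (M : ℝ≥0∞) ^ 2 :=
    (eLpNorm_rieszPressure_le hv).trans (by gcongr)
  have hne : (steinConstThreeHalves : ℝ≥0∞) * (M : ℝ≥0∞) ^ 2 ≠ ⊤ :=
    ENNReal.mul_ne_top ENNReal.coe_ne_top (ENNReal.pow_ne_top ENNReal.coe_ne_top)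
  have h2 := ENNReal.toReal_mono hne h1
  rw [ENNReal.toReal_mul, ENNReal.toReal_pow] at h2
  simpa using h2

/-! ### Hölder on balls against `L³` data -/

/-- The volume of the ball `B̄(x₀, ρ)` in `ℝ³`: `ρ³ vol B̄(0,1)`. [folklore] -/
private theorem volume_real_closedBall (x₀ : (EuclideanSpace ℝ (Fin 3))) {ρ : ℝ} (hρ : 0 ≤ ρ) :
    (volume : Measure (EuclideanSpace ℝ (Fin 3))).real (closedBall x₀ ρ) =
      ρ ^ 3 * (volume : Measure (EuclideanSpace ℝ (Fin 3))).real (closedBall (0 : (EuclideanSpace ℝ (Fin 3))) 1) := by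
  rw [Measure.addHaar_real_closedBall' volume x₀ hρ, finrank_euclideanSpace_fin]

/-- **`∫_B ‖v‖ ≤ (s² ∫‖v‖³ + 2 s⁻¹ |B|)/3`** (AM–GM integrated). [folklore] -/
theorem setIntegral_norm_le {v : (EuclideanSpace ℝ (Fin 3)) → (EuclideanSpace ℝ (Fin 3))}
    (hv3 : Integrable (fun y => ‖v y‖ ^ 3) volume) (x₀ : (EuclideanSpace ℝ (Fin 3))) (ρ : ℝ) {s : ℝ} (hs : 0 < s) :
    ∫ y in closedBall x₀ ρ, ‖v y‖ ≤
      (s ^ 2 * (∫ y, ‖v y‖ ^ 3) + 2 * s⁻¹ * (volume : Measure (EuclideanSpace ℝ (Fin 3))).real (closedBall x₀ ρ)) / 3 := by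
  set B := closedBall x₀ ρ with hB
  have hBm : MeasurableSet B := measurableSet_closedBall
  have hBfin : volume B < ⊤ := measure_closedBall_lt_top
  have hGi : IntegrableOn (fun y => (s ^ 2 * ‖v y‖ ^ 3 + 2 * s⁻¹) / 3) B volume :=
    ((hv3.const_mul _).integrableOn.add (integrableOn_const hBfin.ne)).div_const 3
  calc ∫ y in B, ‖v y‖ ≤ ∫ y in B, (s ^ 2 * ‖v y‖ ^ 3 + 2 * s⁻¹) / 3 :=
        integral_mono_of_nonneg (Eventually.of_forall fun y => norm_nonneg _) hGi
          (Eventually.of_forall fun y => le_amgm_one (norm_nonneg _) hs)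
    _ = (s ^ 2 * (∫ y in B, ‖v y‖ ^ 3) + 2 * s⁻¹ * (volume : Measure (EuclideanSpace ℝ (Fin 3))).real B) / 3 := by
        rw [integral_div, integral_add (hv3.const_mul _).integrableOn (integrableOn_const hBfin.ne),
          integral_const_mul, setIntegral_const, smul_eq_mul, mul_comm _ (2 * s⁻¹)]
    _ ≤ (s ^ 2 * (∫ y, ‖v y‖ ^ 3) + 2 * s⁻¹ * (volume : Measure (EuclideanSpace ℝ (Fin 3))).real B) / 3 := by
        have hle : ∫ y in B, ‖v y‖ ^ 3 ≤ ∫ y, ‖v y‖ ^ 3 :=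
          setIntegral_le_integral hv3 (Eventually.of_forall fun y => by positivity)
        have := mul_le_mul_of_nonneg_left hle (sq_nonneg s)
        linarith

/-- **`∫_B ‖v‖² ≤ (2s ∫‖v‖³ + s⁻² |B|)/3`** (AM–GM integrated). [folklore] -/
theorem setIntegral_norm_sq_le {v : (EuclideanSpace ℝ (Fin 3)) → (EuclideanSpace ℝ (Fin 3))}
    (hv3 : Integrable (fun y => ‖v y‖ ^ 3) volume) (x₀ : (EuclideanSpace ℝ (Fin 3))) (ρ : ℝ) {s : ℝ} (hs : 0 < s) :
    ∫ y in closedBall x₀ ρ, ‖v y‖ ^ 2 ≤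
      (2 * s * (∫ y, ‖v y‖ ^ 3) + s⁻¹ ^ 2 * (volume : Measure (EuclideanSpace ℝ (Fin 3))).real (closedBall x₀ ρ)) / 3 := by
  set B := closedBall x₀ ρ with hB
  have hBm : MeasurableSet B := measurableSet_closedBall
  have hBfin : volume B < ⊤ := measure_closedBall_lt_top
  have hGi : IntegrableOn (fun y => (2 * s * ‖v y‖ ^ 3 + s⁻¹ ^ 2) / 3) B volume :=
    ((hv3.const_mul _).integrableOn.add (integrableOn_const hBfin.ne)).div_const 3
  calc ∫ y in B, ‖v y‖ ^ 2 ≤ ∫ y in B, (2 * s * ‖v y‖ ^ 3 + s⁻¹ ^ 2) / 3 :=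
        integral_mono_of_nonneg (Eventually.of_forall fun y => by positivity) hGi
          (Eventually.of_forall fun y => sq_le_amgm_two (norm_nonneg _) hs)
    _ = (2 * s * (∫ y in B, ‖v y‖ ^ 3) + s⁻¹ ^ 2 * (volume : Measure (EuclideanSpace ℝ (Fin 3))).real B) / 3 := by
        rw [integral_div, integral_add (hv3.const_mul _).integrableOn (integrableOn_const hBfin.ne),
          integral_const_mul, setIntegral_const, smul_eq_mul, mul_comm _ (s⁻¹ ^ 2)]
    _ ≤ (2 * s * (∫ y, ‖v y‖ ^ 3) + s⁻¹ ^ 2 * (volume : Measure (EuclideanSpace ℝ (Fin 3))).real B) / 3 := by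
        have hle : ∫ y in B, ‖v y‖ ^ 3 ≤ ∫ y, ‖v y‖ ^ 3 :=
          setIntegral_le_integral hv3 (Eventually.of_forall fun y => by positivity)
        have := mul_le_mul_of_nonneg_left hle (by positivity : (0 : ℝ) ≤ 2 * s)
        linarith

/-- **Hölder on a ball for an `L^{3/2}` function**: `∫_B |Π| ≤ |B|^{1/3} ‖Π‖_{L^{3/2}}`. [folklore] -/
theorem setIntegral_abs_le_of_memLp {Q : (EuclideanSpace ℝ (Fin 3)) → ℝ} (hQ : MemLp Q (3 / 2 : ℝ≥0∞) volume)
    (x₀ : (EuclideanSpace ℝ (Fin 3))) (ρ : ℝ) :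
    ∫ y in closedBall x₀ ρ, |Q y| ≤
      ((volume : Measure (EuclideanSpace ℝ (Fin 3))).real (closedBall x₀ ρ)) ^ (3 : ℝ)⁻¹ *
        (eLpNorm Q (3 / 2 : ℝ≥0∞) volume).toReal := by
  set B := closedBall x₀ ρ with hB
  have hBfin : volume B < ⊤ := measure_closedBall_lt_top
  have hm : AEStronglyMeasurable Q (volume.restrict B) := hQ.1.restrict
  -- Hölder in `ℝ≥0∞`
  have h1 : eLpNorm Q 1 (volume.restrict B) ≤
      eLpNorm Q (3 / 2 : ℝ≥0∞) (volume.restrict B) * (volume.restrict B) univ ^ (3 : ℝ)⁻¹ := by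
    have h := eLpNorm_le_eLpNorm_mul_rpow_measure_univ (p := 1) (q := (3 / 2 : ℝ≥0∞))
      one_le_three_halves hm
    have he : 1 / (1 : ℝ≥0∞).toReal - 1 / (3 / 2 : ℝ≥0∞).toReal = (3 : ℝ)⁻¹ := by
      rw [ENNReal.toReal_one, ENNReal.toReal_div]
      norm_num
    rwa [he] at h
  rw [Measure.restrict_apply_univ] at h1
  have h2 : eLpNorm Q 1 (volume.restrict B) ≤ eLpNorm Q (3 / 2 : ℝ≥0∞) volume * volume B ^ (3 : ℝ)⁻¹ :=
    h1.trans (mul_le_mul' (eLpNorm_restrict_le _ _ _ _) le_rfl)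
  have hne : eLpNorm Q (3 / 2 : ℝ≥0∞) volume * volume B ^ (3 : ℝ)⁻¹ ≠ ⊤ :=
    ENNReal.mul_ne_top hQ.eLpNorm_ne_top (ENNReal.rpow_ne_top_of_nonneg (by norm_num) hBfin.ne)
  have h3 := ENNReal.toReal_mono hne h2
  rw [eLpNorm_one_eq_lintegral_enorm, ENNReal.toReal_mul, ← ENNReal.toReal_rpow] at h3
  have e : ∫ y in B, |Q y| = (∫⁻ y in B, ‖Q y‖ₑ).toReal := by
    rw [← integral_norm_eq_lintegral_enorm hm]
    rfl
  rw [e, measureReal_def, mul_comm]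
  exact h3

/-! ### A kernel bound -/

/-- **Integrals against bounded kernels supported in a ball.** If `‖F‖ ≤ κ H` pointwise, `F`
vanishes off the ball `B̄(x₀, ρ)`, `H` is integrable on that ball and `F` is measurable, then
`F` is integrable and `‖∫ F‖ ≤ κ ∫_{B̄(x₀,ρ)} H`. [folklore] -/
theorem norm_integral_le_of_kernel_bound {F' : Type*} [NormedAddCommGroup F'] [NormedSpace ℝ F']
    {F : (EuclideanSpace ℝ (Fin 3)) → F'} {H : (EuclideanSpace ℝ (Fin 3)) → ℝ} {x₀ : (EuclideanSpace ℝ (Fin 3))} {κ ρ : ℝ}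
    (hHi : IntegrableOn H (closedBall x₀ ρ) volume) (hFm : AEStronglyMeasurable F volume)
    (hF : ∀ y, ‖F y‖ ≤ κ * H y) (hF0 : ∀ y, ρ < dist y x₀ → F y = 0) :
    Integrable F ∧ ‖∫ y, F y‖ ≤ κ * ∫ y in closedBall x₀ ρ, H y := by
  set B := closedBall x₀ ρ with hB
  have hBm : MeasurableSet B := measurableSet_closedBall
  set G : (EuclideanSpace ℝ (Fin 3)) → ℝ := B.indicator fun y => κ * H y with hG
  have hHi' : IntegrableOn (fun y => κ * H y) B volume := hHi.const_mul κ
  have hGi : Integrable G := hHi'.integrable_indicator hBm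
  have hle : ∀ y, ‖F y‖ ≤ G y := fun y => by
    by_cases hy : y ∈ B
    · rw [hG, indicator_of_mem hy]; exact hF y
    · have hy' : ρ < dist y x₀ := by rwa [hB, mem_closedBall, not_le] at hy
      rw [hG, indicator_of_notMem hy, hF0 y hy', norm_zero]
  have hFi : Integrable F := Integrable.mono' hGi hFm (Eventually.of_forall hle)
  refine ⟨hFi, ?_⟩
  calc ‖∫ y, F y‖ ≤ ∫ y, G y := norm_integral_le_of_norm_le hGi (Eventually.of_forall hle)
    _ = κ * ∫ y in B, H y := by rw [hG, integral_indicator hBm, integral_const_mul]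

/-! ### The four probe terms are `O(R⁻¹)` -/

section Bounds

variable (φ : ContDiffBump (0 : (EuclideanSpace ℝ (Fin 3))))

/-- Support of the translated combined test function: `Φ(x₀ − y) = 0` for `dist y x₀ > 2R + 1`
(`rOut ≤ 1`). [folklore] -/
theorem probeConv_comp_sub_eq_zero (hφ : φ.rOut ≤ 1) {R : ℝ} (hR : 0 < R) (x₀ : (EuclideanSpace ℝ (Fin 3))) {y : (EuclideanSpace ℝ (Fin 3))}
    (hy : 2 * R + 1 < dist y x₀) : (probeBump R ⋆ φ.normed volume) (x₀ - y) = 0 := by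
  refine probeConv_eq_zero φ hR ?_
  rw [← norm_neg, neg_sub, ← dist_eq_norm]
  linarith

/-- The ball `B̄(x₀, 2R+1)` has volume `≤ 27R³ vol B̄(0,1)` for `R ≥ 1`. [folklore] -/
private theorem volume_real_closedBall_le {R : ℝ} (hR : 1 ≤ R) (x₀ : (EuclideanSpace ℝ (Fin 3))) :
    (volume : Measure (EuclideanSpace ℝ (Fin 3))).real (closedBall x₀ (2 * R + 1)) ≤
      27 * R ^ 3 * (volume : Measure (EuclideanSpace ℝ (Fin 3))).real (closedBall (0 : (EuclideanSpace ℝ (Fin 3))) 1) := by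
  rw [volume_real_closedBall x₀ (by linarith)]
  have h : (2 * R + 1) ^ 3 ≤ 27 * R ^ 3 := by nlinarith [pow_le_pow_left₀ (by linarith : (0:ℝ) ≤ 2 * R + 1) (by linarith : 2 * R + 1 ≤ 3 * R) 3]
  exact mul_le_mul_of_nonneg_right h measureReal_nonneg

/-- **The boundary term** `W = ∫ ⟪v, Φ(x₀ − ·) a⟫` is `O(R⁻¹)`: `|W| ≤ K (1 + N) R⁻¹` whenever
`∫‖v‖³ ≤ N` and `R ≥ 1` (`|Φ| ≤ (mR³)⁻¹` on a ball of volume `≤ 27R³|B₁|`, AM–GM with `s = R`). [folklore] -/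
theorem exists_bound_boundary (hφ : φ.rOut ≤ 1) (a : (EuclideanSpace ℝ (Fin 3))) : ∃ K, 0 ≤ K ∧
    ∀ (v : (EuclideanSpace ℝ (Fin 3)) → (EuclideanSpace ℝ (Fin 3))) (N : ℝ), Continuous v → Integrable (fun y => ‖v y‖ ^ 3) volume → 0 ≤ N →
    ∫ y, ‖v y‖ ^ 3 ≤ N → ∀ R : ℝ, 1 ≤ R → ∀ x₀ : (EuclideanSpace ℝ (Fin 3)),
      (Integrable fun y => ⟪v y, (probeBump R ⋆ φ.normed volume) (x₀ - y) • a⟫) ∧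
      |∫ y, ⟪v y, (probeBump R ⋆ φ.normed volume) (x₀ - y) • a⟫| ≤ K * (1 + N) * R⁻¹ := by
  set m := baseBumpMass (EuclideanSpace ℝ (Fin 3)) with hm_def
  have hm : 0 < m := baseBumpMass_pos
  set V₁ := (volume : Measure (EuclideanSpace ℝ (Fin 3))).real (closedBall (0 : (EuclideanSpace ℝ (Fin 3))) 1) with hV₁
  have hV₁0 : 0 ≤ V₁ := measureReal_nonneg
  refine ⟨‖a‖ * m⁻¹ * (1 + 54 * V₁) / 3, by positivity, ?_⟩
  intro v N hvc hv3 hN0 hN R hR1 x₀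
  have hR : 0 < R := one_pos.trans_le hR1
  set Φ := probeBump R ⋆ φ.normed volume with hΦ
  have hΦc : Continuous Φ := (contDiff_probeConv φ hR (n := 0)).continuous
  -- kernel bound and support
  have hκ : 0 ≤ ‖a‖ * (m * R ^ 3)⁻¹ := by positivity
  have hF : ∀ y, ‖⟪v y, Φ (x₀ - y) • a⟫‖ ≤ ‖a‖ * (m * R ^ 3)⁻¹ * ‖v y‖ := fun y => by
    rw [Real.norm_eq_abs, inner_smul_right, abs_mul]
    calc |Φ (x₀ - y)| * |⟪v y, a⟫| ≤ (m * R ^ 3)⁻¹ * (‖v y‖ * ‖a‖) :=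
          mul_le_mul (abs_probeConv_le φ hR _) (abs_real_inner_le_norm _ _) (abs_nonneg _)
            (by positivity)
      _ = ‖a‖ * (m * R ^ 3)⁻¹ * ‖v y‖ := by ring
  have hF0 : ∀ y, 2 * R + 1 < dist y x₀ → ⟪v y, Φ (x₀ - y) • a⟫ = 0 := fun y hy => by
    rw [hΦ, probeConv_comp_sub_eq_zero φ hφ hR x₀ hy, zero_smul, inner_zero_right]
  have hFm : AEStronglyMeasurable (fun y => ⟪v y, Φ (x₀ - y) • a⟫) volume :=
    (hvc.inner ((hΦc.comp (continuous_const.sub continuous_id)).smul continuous_const)).aestronglyMeasurable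
  obtain ⟨hint, hI⟩ := norm_integral_le_of_kernel_bound
    (hvc.norm.continuousOn.integrableOn_compact (isCompact_closedBall x₀ (2 * R + 1))) hFm hF hF0
  refine ⟨hint, ?_⟩
  rw [← Real.norm_eq_abs]
  refine hI.trans ?_
  -- Hölder / AM–GM on the ball with `s = R`
  have hB := setIntegral_norm_le hv3 x₀ (2 * R + 1) hR
  have hvol := volume_real_closedBall_le hR1 x₀
  calc ‖a‖ * (m * R ^ 3)⁻¹ * ∫ y in closedBall x₀ (2 * R + 1), ‖v y‖
      ≤ ‖a‖ * (m * R ^ 3)⁻¹ * ((R ^ 2 * N + 2 * R⁻¹ * (27 * R ^ 3 * V₁)) / 3) := by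
        refine mul_le_mul_of_nonneg_left (hB.trans ?_) hκ
        gcongr
    _ = ‖a‖ * m⁻¹ * (N + 54 * V₁) / 3 * R⁻¹ := by field_simp; ring
    _ ≤ ‖a‖ * m⁻¹ * (1 + 54 * V₁) / 3 * (1 + N) * R⁻¹ := by
        have h1 : N + 54 * V₁ ≤ (1 + 54 * V₁) * (1 + N) := by nlinarith
        have h2 : ‖a‖ * m⁻¹ * (N + 54 * V₁) / 3 ≤ ‖a‖ * m⁻¹ * (1 + 54 * V₁) / 3 * (1 + N) := by
          calc ‖a‖ * m⁻¹ * (N + 54 * V₁) / 3 = ‖a‖ * m⁻¹ / 3 * (N + 54 * V₁) := by ring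
            _ ≤ ‖a‖ * m⁻¹ / 3 * ((1 + 54 * V₁) * (1 + N)) :=
                mul_le_mul_of_nonneg_left h1 (by positivity)
            _ = _ := by ring
        exact mul_le_mul_of_nonneg_right h2 (inv_nonneg.2 hR.le)
    _ = ‖a‖ * m⁻¹ * (1 + 54 * V₁) / 3 * (1 + N) * R⁻¹ := rfl

/-- **The viscous term** `A = ∫ ⟪v, Δ(Φ(x₀ − ·)) a⟫` is `O(R⁻¹)` (indeed `O(R⁻³)`):
`|ΔΦ| ≤ C₂(mR³)⁻¹R⁻²`. [folklore] -/
theorem exists_bound_laplacian (hφ : φ.rOut ≤ 1) (a : (EuclideanSpace ℝ (Fin 3))) : ∃ K, 0 ≤ K ∧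
    ∀ (v : (EuclideanSpace ℝ (Fin 3)) → (EuclideanSpace ℝ (Fin 3))) (N : ℝ), Continuous v → Integrable (fun y => ‖v y‖ ^ 3) volume → 0 ≤ N →
    ∫ y, ‖v y‖ ^ 3 ≤ N → ∀ R : ℝ, 1 ≤ R → ∀ x₀ : (EuclideanSpace ℝ (Fin 3)),
      |∫ y, ⟪v y, (Δ (fun y => (probeBump R ⋆ φ.normed volume) (x₀ - y))) y • a⟫| ≤
        K * (1 + N) * R⁻¹ := by
  obtain ⟨⟨C₁, hC₁⟩, ⟨C₂, hC₂⟩⟩ := exists_bound_baseBump_derivs (E := (EuclideanSpace ℝ (Fin 3)))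
  have hC₂0 : 0 ≤ C₂ := (abs_nonneg _).trans (hC₂ 0)
  set m := baseBumpMass (EuclideanSpace ℝ (Fin 3)) with hm_def
  have hm : 0 < m := baseBumpMass_pos
  set V₁ := (volume : Measure (EuclideanSpace ℝ (Fin 3))).real (closedBall (0 : (EuclideanSpace ℝ (Fin 3))) 1) with hV₁
  have hV₁0 : 0 ≤ V₁ := measureReal_nonneg
  refine ⟨‖a‖ * m⁻¹ * C₂ * (1 + 54 * V₁) / 3, by positivity, ?_⟩
  intro v N hvc hv3 hN0 hN R hR1 x₀
  have hR : 0 < R := one_pos.trans_le hR1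
  set Φ := probeBump R ⋆ φ.normed volume with hΦ
  have hΦ2 : ContDiff ℝ 2 Φ := contDiff_probeConv φ hR
  set L : (EuclideanSpace ℝ (Fin 3)) → ℝ := Δ (fun y => Φ (x₀ - y)) with hL
  have hL' : ∀ y, L y = (Δ Φ) (x₀ - y) := fun y => laplacian_comp_const_sub Φ x₀ y
  have hLc : Continuous L := by
    have : L = fun y => (Δ Φ) (x₀ - y) := funext hL'
    rw [this]
    exact (FluidPDE.continuous_laplacian hΦ2).comp (continuous_const.sub continuous_id)
  have hκ : 0 ≤ ‖a‖ * ((m * R ^ 3)⁻¹ * R⁻¹ ^ 2 * C₂) := by positivity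
  have hF : ∀ y, ‖⟪v y, L y • a⟫‖ ≤ ‖a‖ * ((m * R ^ 3)⁻¹ * R⁻¹ ^ 2 * C₂) * ‖v y‖ := fun y => by
    rw [Real.norm_eq_abs, inner_smul_right, abs_mul, hL' y]
    calc |(Δ Φ) (x₀ - y)| * |⟪v y, a⟫| ≤ ((m * R ^ 3)⁻¹ * R⁻¹ ^ 2 * C₂) * (‖v y‖ * ‖a‖) :=
          mul_le_mul (abs_laplacian_probeConv_le φ hR hC₂ _) (abs_real_inner_le_norm _ _)
            (abs_nonneg _) (by positivity)
      _ = ‖a‖ * ((m * R ^ 3)⁻¹ * R⁻¹ ^ 2 * C₂) * ‖v y‖ := by ring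
  have hF0 : ∀ y, 2 * R + 1 < dist y x₀ → ⟪v y, L y • a⟫ = 0 := fun y hy => by
    rw [hL' y, laplacian_probeConv_eq_zero φ hR, zero_smul, inner_zero_right]
    rw [← norm_neg, neg_sub, ← dist_eq_norm]
    linarith
  have hFm : AEStronglyMeasurable (fun y => ⟪v y, L y • a⟫) volume :=
    (hvc.inner (hLc.smul continuous_const)).aestronglyMeasurable
  obtain ⟨-, hI⟩ := norm_integral_le_of_kernel_bound
    (hvc.norm.continuousOn.integrableOn_compact (isCompact_closedBall x₀ (2 * R + 1))) hFm hF hF0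
  rw [← Real.norm_eq_abs]
  refine hI.trans ?_
  have hB := setIntegral_norm_le hv3 x₀ (2 * R + 1) hR
  have hvol := volume_real_closedBall_le hR1 x₀
  have hRi : R⁻¹ ≤ 1 := inv_le_one_of_one_le₀ hR1
  have hRi0 : 0 ≤ R⁻¹ := inv_nonneg.2 hR.le
  calc ‖a‖ * ((m * R ^ 3)⁻¹ * R⁻¹ ^ 2 * C₂) * ∫ y in closedBall x₀ (2 * R + 1), ‖v y‖
      ≤ ‖a‖ * ((m * R ^ 3)⁻¹ * R⁻¹ ^ 2 * C₂) * ((R ^ 2 * N + 2 * R⁻¹ * (27 * R ^ 3 * V₁)) / 3) := by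
        refine mul_le_mul_of_nonneg_left (hB.trans ?_) hκ
        gcongr
    _ = ‖a‖ * m⁻¹ * C₂ * (N + 54 * V₁) / 3 * R⁻¹ ^ 3 := by field_simp; ring
    _ ≤ ‖a‖ * m⁻¹ * C₂ * (1 + 54 * V₁) / 3 * (1 + N) * R⁻¹ := by
        have h1 : N + 54 * V₁ ≤ (1 + 54 * V₁) * (1 + N) := by nlinarith
        have h3 : R⁻¹ ^ 3 ≤ R⁻¹ := by
          calc R⁻¹ ^ 3 ≤ R⁻¹ ^ 1 := pow_le_pow_of_le_one hRi0 hRi (by norm_num)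
            _ = R⁻¹ := pow_one _
        calc ‖a‖ * m⁻¹ * C₂ * (N + 54 * V₁) / 3 * R⁻¹ ^ 3
            = (‖a‖ * m⁻¹ * C₂ / 3) * ((N + 54 * V₁) * R⁻¹ ^ 3) := by ring
          _ ≤ (‖a‖ * m⁻¹ * C₂ / 3) * (((1 + 54 * V₁) * (1 + N)) * R⁻¹) := by
              refine mul_le_mul_of_nonneg_left ?_ (by positivity)
              exact mul_le_mul h1 h3 (by positivity) (by positivity)
          _ = _ := by ring

/-- **The transport term** `B = ∫ ⟪v, (v·∇)(Φ(x₀ − ·)) a⟫` is `O(R⁻¹)` (indeed `O(R⁻³)`):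
`‖DΦ‖ ≤ C₁(mR³)⁻¹R⁻¹` against `∫_B ‖v‖² ≤ (2R∫‖v‖³ + R⁻²|B|)/3`. [folklore] -/
theorem exists_bound_transport (hφ : φ.rOut ≤ 1) (a : (EuclideanSpace ℝ (Fin 3))) : ∃ K, 0 ≤ K ∧
    ∀ (v : (EuclideanSpace ℝ (Fin 3)) → (EuclideanSpace ℝ (Fin 3))) (N : ℝ), Continuous v → Integrable (fun y => ‖v y‖ ^ 3) volume → 0 ≤ N →
    ∫ y, ‖v y‖ ^ 3 ≤ N → ∀ R : ℝ, 1 ≤ R → ∀ x₀ : (EuclideanSpace ℝ (Fin 3)),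
      |∫ y, ⟪v y, fderiv ℝ (fun y => (probeBump R ⋆ φ.normed volume) (x₀ - y)) y (v y) • a⟫| ≤
        K * (1 + N) * R⁻¹ := by
  obtain ⟨⟨C₁, hC₁⟩, ⟨C₂, hC₂⟩⟩ := exists_bound_baseBump_derivs (E := (EuclideanSpace ℝ (Fin 3)))
  have hC₁0 : 0 ≤ C₁ := (norm_nonneg _).trans (hC₁ 0)
  set m := baseBumpMass (EuclideanSpace ℝ (Fin 3)) with hm_def
  have hm : 0 < m := baseBumpMass_pos
  set V₁ := (volume : Measure (EuclideanSpace ℝ (Fin 3))).real (closedBall (0 : (EuclideanSpace ℝ (Fin 3))) 1) with hV₁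
  have hV₁0 : 0 ≤ V₁ := measureReal_nonneg
  refine ⟨‖a‖ * m⁻¹ * C₁ * (2 + 27 * V₁) / 3, by positivity, ?_⟩
  intro v N hvc hv3 hN0 hN R hR1 x₀
  have hR : 0 < R := one_pos.trans_le hR1
  set Φ := probeBump R ⋆ φ.normed volume with hΦ
  have hΦ1 : ContDiff ℝ 1 Φ := contDiff_probeConv φ hR
  have hD : ∀ y, fderiv ℝ (fun y => Φ (x₀ - y)) y = -fderiv ℝ Φ (x₀ - y) := fun y =>
    fderiv_comp_const_sub Φ x₀ y
  have hκ : 0 ≤ ‖a‖ * ((m * R ^ 3)⁻¹ * R⁻¹ * C₁) := by positivity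
  have hF : ∀ y, ‖⟪v y, fderiv ℝ (fun y => Φ (x₀ - y)) y (v y) • a⟫‖ ≤
      ‖a‖ * ((m * R ^ 3)⁻¹ * R⁻¹ * C₁) * ‖v y‖ ^ 2 := fun y => by
    rw [Real.norm_eq_abs, inner_smul_right, abs_mul, hD y]
    calc |(-fderiv ℝ Φ (x₀ - y)) (v y)| * |⟪v y, a⟫|
        ≤ (‖fderiv ℝ Φ (x₀ - y)‖ * ‖v y‖) * (‖v y‖ * ‖a‖) := by
          refine mul_le_mul ?_ (abs_real_inner_le_norm _ _) (abs_nonneg _) (by positivity)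
          rw [_root_.neg_apply, abs_neg, ← Real.norm_eq_abs]
          exact ContinuousLinearMap.le_opNorm _ _
      _ ≤ (((m * R ^ 3)⁻¹ * R⁻¹ * C₁) * ‖v y‖) * (‖v y‖ * ‖a‖) := by
          gcongr
          exact norm_fderiv_probeConv_le φ hR hC₁ _
      _ = ‖a‖ * ((m * R ^ 3)⁻¹ * R⁻¹ * C₁) * ‖v y‖ ^ 2 := by ring
  have hF0 : ∀ y, 2 * R + 1 < dist y x₀ → ⟪v y, fderiv ℝ (fun y => Φ (x₀ - y)) y (v y) • a⟫ = 0 := by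
    intro y hy
    have hy' : 2 * R + φ.rOut < ‖x₀ - y‖ := by
      rw [← norm_neg, neg_sub, ← dist_eq_norm]; linarith
    have hz : fderiv ℝ Φ (x₀ - y) = 0 := by
      ext w
      rw [fderiv_probeConv_apply_eq_zero φ hR hy']
      rfl
    rw [hD y, hz, neg_zero, _root_.zero_apply, zero_smul, inner_zero_right]
  have hFm : AEStronglyMeasurable
      (fun y => ⟪v y, fderiv ℝ (fun y => Φ (x₀ - y)) y (v y) • a⟫) volume := by
    have hc : Continuous fun y => fderiv ℝ (fun y => Φ (x₀ - y)) y (v y) := by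
      have e : (fun y => fderiv ℝ (fun y => Φ (x₀ - y)) y (v y)) =
          fun y => (-fderiv ℝ Φ (x₀ - y)) (v y) := funext fun y => by rw [hD y]
      rw [e]
      exact ((hΦ1.continuous_fderiv one_ne_zero).comp (continuous_const.sub continuous_id)).neg.clm_apply
        hvc
    exact (hvc.inner (hc.smul continuous_const)).aestronglyMeasurable
  obtain ⟨-, hI⟩ := norm_integral_le_of_kernel_bound
    ((hvc.norm.pow 2).continuousOn.integrableOn_compact (isCompact_closedBall x₀ (2 * R + 1)))
    hFm hF hF0
  rw [← Real.norm_eq_abs]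
  refine hI.trans ?_
  have hB := setIntegral_norm_sq_le hv3 x₀ (2 * R + 1) hR
  have hvol := volume_real_closedBall_le hR1 x₀
  have hRi : R⁻¹ ≤ 1 := inv_le_one_of_one_le₀ hR1
  have hRi0 : 0 ≤ R⁻¹ := inv_nonneg.2 hR.le
  calc ‖a‖ * ((m * R ^ 3)⁻¹ * R⁻¹ * C₁) * ∫ y in closedBall x₀ (2 * R + 1), ‖v y‖ ^ 2
      ≤ ‖a‖ * ((m * R ^ 3)⁻¹ * R⁻¹ * C₁) * ((2 * R * N + R⁻¹ ^ 2 * (27 * R ^ 3 * V₁)) / 3) := by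
        refine mul_le_mul_of_nonneg_left (hB.trans ?_) hκ
        gcongr
    _ = ‖a‖ * m⁻¹ * C₁ * (2 * N + 27 * V₁) / 3 * R⁻¹ ^ 3 := by field_simp
    _ ≤ ‖a‖ * m⁻¹ * C₁ * (2 + 27 * V₁) / 3 * (1 + N) * R⁻¹ := by
        have h1 : 2 * N + 27 * V₁ ≤ (2 + 27 * V₁) * (1 + N) := by nlinarith
        have h3 : R⁻¹ ^ 3 ≤ R⁻¹ := by
          calc R⁻¹ ^ 3 ≤ R⁻¹ ^ 1 := pow_le_pow_of_le_one hRi0 hRi (by norm_num)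
            _ = R⁻¹ := pow_one _
        calc ‖a‖ * m⁻¹ * C₁ * (2 * N + 27 * V₁) / 3 * R⁻¹ ^ 3
            = (‖a‖ * m⁻¹ * C₁ / 3) * ((2 * N + 27 * V₁) * R⁻¹ ^ 3) := by ring
          _ ≤ (‖a‖ * m⁻¹ * C₁ / 3) * (((2 + 27 * V₁) * (1 + N)) * R⁻¹) := by
              refine mul_le_mul_of_nonneg_left ?_ (by positivity)
              exact mul_le_mul h1 h3 (by positivity) (by positivity)
          _ = _ := by ring

/-- **The potential term** `D = ∫ ∂ₐΦ(y) Π(x₀ − y) dy` is `O(R⁻¹)` (indeed `O(R⁻³)`) for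
`Π ∈ L^{3/2}` with `‖Π‖_{3/2} ≤ P`: `|∂ₐΦ| ≤ C₁(mR³)⁻¹R⁻¹‖a‖` against `∫_B |Π| ≤ |B|^{1/3} P`. [folklore] -/
theorem exists_bound_potential (hφ : φ.rOut ≤ 1) (a : (EuclideanSpace ℝ (Fin 3))) : ∃ K, 0 ≤ K ∧
    ∀ (Q : (EuclideanSpace ℝ (Fin 3)) → ℝ) (P : ℝ), MemLp Q (3 / 2 : ℝ≥0∞) volume → 0 ≤ P →
    (eLpNorm Q (3 / 2 : ℝ≥0∞) volume).toReal ≤ P → ∀ R : ℝ, 1 ≤ R → ∀ x₀ : (EuclideanSpace ℝ (Fin 3)),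
      |∫ y, fderiv ℝ (probeBump R ⋆ φ.normed volume) y a * Q (x₀ - y)| ≤ K * (1 + P) * R⁻¹ := by
  obtain ⟨⟨C₁, hC₁⟩, ⟨C₂, hC₂⟩⟩ := exists_bound_baseBump_derivs (E := (EuclideanSpace ℝ (Fin 3)))
  have hC₁0 : 0 ≤ C₁ := (norm_nonneg _).trans (hC₁ 0)
  set m := baseBumpMass (EuclideanSpace ℝ (Fin 3)) with hm_def
  have hm : 0 < m := baseBumpMass_pos
  set V₁ := (volume : Measure (EuclideanSpace ℝ (Fin 3))).real (closedBall (0 : (EuclideanSpace ℝ (Fin 3))) 1) with hV₁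
  have hV₁0 : 0 ≤ V₁ := measureReal_nonneg
  refine ⟨‖a‖ * m⁻¹ * C₁ * (27 * V₁) ^ (3 : ℝ)⁻¹, by positivity, ?_⟩
  intro Q P hQ hP0 hP R hR1 x₀
  have hR : 0 < R := one_pos.trans_le hR1
  set Φ := probeBump R ⋆ φ.normed volume with hΦ
  have hΦ1 : ContDiff ℝ 1 Φ := contDiff_probeConv φ hR
  have hΦa : Continuous fun y => fderiv ℝ Φ y a :=
    (hΦ1.continuous_fderiv one_ne_zero).clm_apply continuous_const
  -- move the translation onto the kernel
  rw [← integral_sub_left_eq_self (fun y => fderiv ℝ Φ y a * Q (x₀ - y)) volume x₀]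
  simp only [sub_sub_cancel]
  have hκ : 0 ≤ (m * R ^ 3)⁻¹ * R⁻¹ * C₁ * ‖a‖ := by positivity
  have hF : ∀ y, ‖fderiv ℝ Φ (x₀ - y) a * Q y‖ ≤ (m * R ^ 3)⁻¹ * R⁻¹ * C₁ * ‖a‖ * |Q y| := fun y => by
    rw [Real.norm_eq_abs, abs_mul]
    exact mul_le_mul_of_nonneg_right (abs_fderiv_probeConv_apply_le φ hR hC₁ _ a) (abs_nonneg _)
  have hF0 : ∀ y, 2 * R + 1 < dist y x₀ → fderiv ℝ Φ (x₀ - y) a * Q y = 0 := fun y hy => by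
    have hy' : 2 * R + φ.rOut < ‖x₀ - y‖ := by
      rw [← norm_neg, neg_sub, ← dist_eq_norm]; linarith
    rw [fderiv_probeConv_apply_eq_zero φ hR hy', zero_mul]
  have hFm : AEStronglyMeasurable (fun y => fderiv ℝ Φ (x₀ - y) a * Q y) volume :=
    ((hΦa.comp (continuous_const.sub continuous_id)).aestronglyMeasurable).mul hQ.1
  obtain ⟨-, hI⟩ := norm_integral_le_of_kernel_bound
    (((hQ.locallyIntegrable one_le_three_halves).integrableOn_isCompact
      (isCompact_closedBall x₀ (2 * R + 1))).abs) hFm hF hF0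
  rw [← Real.norm_eq_abs]
  refine hI.trans ?_
  have hB := setIntegral_abs_le_of_memLp hQ x₀ (2 * R + 1)
  have hvol := volume_real_closedBall_le hR1 x₀
  have hRi : R⁻¹ ≤ 1 := inv_le_one_of_one_le₀ hR1
  have hRi0 : 0 ≤ R⁻¹ := inv_nonneg.2 hR.le
  -- `|B|^{1/3} ≤ 3 R (27 V₁)^{1/3} / 3 = R (27 V₁)^{1/3}`
  have hroot : ((volume : Measure (EuclideanSpace ℝ (Fin 3))).real (closedBall x₀ (2 * R + 1))) ^ (3 : ℝ)⁻¹ ≤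
      R * (27 * V₁) ^ (3 : ℝ)⁻¹ := by
    calc ((volume : Measure (EuclideanSpace ℝ (Fin 3))).real (closedBall x₀ (2 * R + 1))) ^ (3 : ℝ)⁻¹
        ≤ (27 * R ^ 3 * V₁) ^ (3 : ℝ)⁻¹ := Real.rpow_le_rpow measureReal_nonneg hvol (by norm_num)
      _ = (R ^ 3) ^ (3 : ℝ)⁻¹ * (27 * V₁) ^ (3 : ℝ)⁻¹ := by
          rw [show 27 * R ^ 3 * V₁ = R ^ 3 * (27 * V₁) by ring,
            Real.mul_rpow (by positivity) (by positivity)]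
      _ = R * (27 * V₁) ^ (3 : ℝ)⁻¹ := by
          congr 1
          have := Real.pow_rpow_inv_natCast hR.le (n := 3) three_ne_zero
          exact_mod_cast this
  calc (m * R ^ 3)⁻¹ * R⁻¹ * C₁ * ‖a‖ * ∫ y in closedBall x₀ (2 * R + 1), |Q y|
      ≤ (m * R ^ 3)⁻¹ * R⁻¹ * C₁ * ‖a‖ * (R * (27 * V₁) ^ (3 : ℝ)⁻¹ * P) := by
        refine mul_le_mul_of_nonneg_left (hB.trans ?_) hκ
        exact mul_le_mul hroot hP ENNReal.toReal_nonneg (by positivity)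
    _ = ‖a‖ * m⁻¹ * C₁ * (27 * V₁) ^ (3 : ℝ)⁻¹ * P * R⁻¹ ^ 3 := by field_simp
    _ ≤ ‖a‖ * m⁻¹ * C₁ * (27 * V₁) ^ (3 : ℝ)⁻¹ * (1 + P) * R⁻¹ := by
        have h3 : R⁻¹ ^ 3 ≤ R⁻¹ := by
          calc R⁻¹ ^ 3 ≤ R⁻¹ ^ 1 := pow_le_pow_of_le_one hRi0 hRi (by norm_num)
            _ = R⁻¹ := pow_one _
        have h1 : P ≤ 1 + P := by linarith
        calc ‖a‖ * m⁻¹ * C₁ * (27 * V₁) ^ (3 : ℝ)⁻¹ * P * R⁻¹ ^ 3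
            = (‖a‖ * m⁻¹ * C₁ * (27 * V₁) ^ (3 : ℝ)⁻¹) * (P * R⁻¹ ^ 3) := by ring
          _ ≤ (‖a‖ * m⁻¹ * C₁ * (27 * V₁) ^ (3 : ℝ)⁻¹) * ((1 + P) * R⁻¹) := by
              refine mul_le_mul_of_nonneg_left ?_ (by positivity)
              exact mul_le_mul h1 h3 (by positivity) (by positivity)
          _ = _ := by ring

end Bounds

/-! ### The boundary term in time -/

variable {S : Set ℝ} {ν : ℝ} {u : ℝ → (EuclideanSpace ℝ (Fin 3)) → (EuclideanSpace ℝ (Fin 3))} {p : ℝ → (EuclideanSpace ℝ (Fin 3)) → ℝ}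

/-- **Differentiating the boundary term in time** (open time set): for a classical solution on
`S` and a smooth compactly supported test field `Ψ`, `s ↦ ∫ ⟪u(s, y), Ψ(y)⟫ dy` has derivative
`∫ ⟪∂ₜu(t, y), Ψ(y)⟫ dy` at every `t ∈ S`. [folklore] -/
theorem hasDerivAt_integral_inner_velocity (h : IsClassicalNSSolutionOn S ν 0 u p) (hS : IsOpen S)
    {Ψ : (EuclideanSpace ℝ (Fin 3)) → (EuclideanSpace ℝ (Fin 3))} (hΨ : ContDiff ℝ ∞ Ψ) (hΨc : HasCompactSupport Ψ) {t : ℝ} (ht : t ∈ S) :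
    HasDerivAt (fun s => ∫ y, ⟪u s y, Ψ y⟫)
      (∫ y, ⟪FluidPDE.timeDerivWithin S u t y, Ψ y⟫) t := by
  have hΦ : FluidPDE.IsSmoothSpaceTimeOn S fun s y => ⟪u s y, Ψ y⟫ :=
    h.smooth_velocity.inner (FluidPDE.isSmoothSpaceTimeOn_const_time hΨ _)
  have hsupp : ∀ s ∈ S, ∀ y ∉ tsupport Ψ, ⟪u s y, Ψ y⟫ = 0 := fun s _ y hy => by
    rw [image_eq_zero_of_notMem_tsupport hy, inner_zero_right]
  have hD := FluidPDE.hasDerivAt_integral_of_support_subset (μ := volume) hS hΦ hΨc hsupp ht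
  have heq : ∫ y, deriv (fun s => ⟪u s y, Ψ y⟫) t = ∫ y, ⟪FluidPDE.timeDerivWithin S u t y, Ψ y⟫ := by
    refine integral_congr_ae (Eventually.of_forall fun y => ?_)
    have hl : HasDerivAt (fun s => u s y) (deriv (fun s => u s y) t) t :=
      h.smooth_velocity.hasDerivAt_timeLine hS ht y
    have := (hl.inner ℝ (hasDerivAt_const t (Ψ y))).deriv
    simp only [inner_zero_right, zero_add] at this
    show deriv (fun s => ⟪u s y, Ψ y⟫) t = ⟪FluidPDE.timeDerivWithin S u t y, Ψ y⟫
    rw [this, FluidPDE.timeDerivWithin_eq_deriv_of_mem_nhds (hS.mem_nhds ht) u y]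
  rwa [heq] at hD

/-- The time-derivative term `t ↦ ∫ ⟪∂ₜu(t, y), Ψ(y)⟫ dy` is continuous on the open time set. [folklore] -/
theorem continuousOn_integral_inner_timeDerivWithin (h : IsClassicalNSSolutionOn S ν 0 u p)
    (hS : IsOpen S) {Ψ : (EuclideanSpace ℝ (Fin 3)) → (EuclideanSpace ℝ (Fin 3))} (hΨ : Continuous Ψ) (hΨc : HasCompactSupport Ψ) :
    ContinuousOn (fun t => ∫ y, ⟪FluidPDE.timeDerivWithin S u t y, Ψ y⟫) S := by
  refine FluidPDE.continuousOn_integral_of_support_subset (μ := volume) (K := tsupport Ψ) hΨc ?_ ?_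
  · have h1 := h.smooth_velocity.continuousOn_timeDerivWithin hS.uniqueDiffOn
    have h2 : ContinuousOn (fun z : ℝ × (EuclideanSpace ℝ (Fin 3)) => Ψ z.2) (S ×ˢ univ) :=
      (hΨ.comp continuous_snd).continuousOn
    exact h1.inner h2
  · intro s _ y hy
    change ⟪FluidPDE.timeDerivWithin S u s y, Ψ y⟫ = 0
    rw [image_eq_zero_of_notMem_tsupport hy, inner_zero_right]

/-! ### Assembly: `∇(θ ⋆ g(t)) = 0` and the a.e. identity -/

/-- **`∇(θ ⋆ (p(t) − Π[u(t)])) = 0`** (Tao 2011, §4, conclusion of the proof of Lemma 4.1 (i),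
for `L³` slices). For a classical solution of the unforced system on `(t₁, t₂)` with `ν ≥ 0`,
slices in `L³` and `‖u(t)‖_{L³} ≤ M` on `(t₁, t₂)`, and every normed bump `θ` of outer radius
`≤ 1`: the mollified harmonic part has vanishing derivative at every point, for every
`t ∈ (t₁, t₂)` — by the probe identity `∂ₐ(θ ⋆ g)(t, x₀) = −W_R'(t) + O((1 + M³)/R)` with
`|W_R| = O((1 + M³)/R)` uniformly in `t`, and the real-variable uniqueness lemma of
`HarmonicProbe`. [cite: Tao2011, §4, proof of Lemma 4.1 (i)] -/
theorem fderiv_mollified_harmonicPart_eq_zero {t₁ t₂ : ℝ} (hν : 0 ≤ ν)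
    (h : IsClassicalNSSolutionOn (Ioo t₁ t₂) ν 0 u p)
    (h3 : ∀ t ∈ Ioo t₁ t₂, MemLp (u t) 3 volume) {M : ℝ≥0}
    (hM : ∀ t ∈ Ioo t₁ t₂, eLpNorm (u t) 3 volume ≤ M) (φ : ContDiffBump (0 : (EuclideanSpace ℝ (Fin 3))))
    (hφ : φ.rOut ≤ 1) (x₀ a : (EuclideanSpace ℝ (Fin 3))) :
    ∀ t ∈ Ioo t₁ t₂, fderiv ℝ (φ.normed volume ⋆ fun x => p t x - rieszPressure (u t) x) x₀ a = 0 := by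
  have hS : IsOpen (Ioo t₁ t₂) := isOpen_Ioo
  -- the constants of the four bounds
  obtain ⟨K₁, hK₁0, hK₁⟩ := exists_bound_laplacian φ hφ a
  obtain ⟨K₂, hK₂0, hK₂⟩ := exists_bound_transport φ hφ a
  obtain ⟨K₃, hK₃0, hK₃⟩ := exists_bound_boundary φ hφ a
  obtain ⟨K₄, hK₄0, hK₄⟩ := exists_bound_potential φ hφ a
  set N : ℝ := (M : ℝ) ^ 3 with hN
  have hN0 : 0 ≤ N := by positivity
  set P : ℝ := steinConstThreeHalves * (M : ℝ) ^ 2 with hP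
  have hP0 : 0 ≤ P := by positivity
  obtain ⟨K, hK⟩ : ∃ K : ℝ, K = (ν * K₁ + K₂ + K₃) * (1 + N) + K₄ * (1 + P) := ⟨_, rfl⟩
  have hKnn : 0 ≤ K := by rw [hK]; positivity
  have hνK : 0 ≤ ν * K₁ := mul_nonneg hν hK₁0
  have hK3le : K₃ * (1 + N) ≤ K := by
    rw [hK]; nlinarith [mul_nonneg hK₄0 (by positivity : (0:ℝ) ≤ 1 + P), mul_nonneg hνK (by positivity : (0:ℝ) ≤ 1 + N), mul_nonneg hK₂0 (by positivity : (0:ℝ) ≤ 1 + N)]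
  have hK124le : (ν * K₁ + K₂) * (1 + N) + K₄ * (1 + P) ≤ K := by
    rw [hK]; nlinarith [mul_nonneg hK₃0 (by positivity : (0:ℝ) ≤ 1 + N)]
  -- data along the flow
  have hdata : ∀ t ∈ Ioo t₁ t₂, Continuous (u t) ∧ Integrable (fun y => ‖u t y‖ ^ 3) volume ∧
      ∫ y, ‖u t y‖ ^ 3 ≤ N ∧ MemLp (rieszPressure (u t)) (3 / 2 : ℝ≥0∞) volume ∧
      (eLpNorm (rieszPressure (u t)) (3 / 2 : ℝ≥0∞) volume).toReal ≤ P := fun t ht =>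
    ⟨(h.contDiff_velocity ht).continuous, (h3 t ht).integrable_norm_pow three_ne_zero,
      integral_norm_pow_three_le (h3 t ht) (hM t ht), memLp_rieszPressure (h3 t ht),
      toReal_eLpNorm_rieszPressure_le (h3 t ht) (hM t ht)⟩
  refine eq_zero_of_approx_antiderivative fun ε hε => ?_
  -- the scale `R ≥ 1` with `K/R ≤ ε`
  obtain ⟨R, hR⟩ : ∃ R : ℝ, R = max 1 (K / ε) := ⟨_, rfl⟩
  have hR1 : 1 ≤ R := by rw [hR]; exact le_max_left _ _
  have hR0 : 0 < R := one_pos.trans_le hR1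
  have hRi : 0 ≤ R⁻¹ := inv_nonneg.2 hR0.le
  have hKR : K * R⁻¹ ≤ ε := by
    rw [← div_eq_mul_inv, div_le_iff₀ hR0]
    calc K = K / ε * ε := by field_simp
      _ ≤ R * ε := by gcongr; rw [hR]; exact le_max_right _ _
      _ = ε * R := mul_comm _ _
  -- the test field `Ψ(y) = Φ(x₀ - y) a` and the boundary term
  set Φ := probeBump R ⋆ φ.normed volume with hΦdef
  have hΦs : ContDiff ℝ ∞ Φ := contDiff_probeConv φ hR0
  have hΦc : HasCompactSupport Φ := hasCompactSupport_probeConv φ hR0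
  have hΨs : ContDiff ℝ ∞ fun y : (EuclideanSpace ℝ (Fin 3)) => Φ (x₀ - y) • a :=
    (hΦs.comp (contDiff_const.sub contDiff_id)).smul contDiff_const
  have hΨc : HasCompactSupport fun y : (EuclideanSpace ℝ (Fin 3)) => Φ (x₀ - y) • a :=
    (hΦc.comp_homeomorph (Homeomorph.subLeft x₀)).smul_right (f' := fun _ => a)
  refine ⟨fun s => ∫ y, ⟪u s y, Φ (x₀ - y) • a⟫,
    fun s => ∫ y, ⟪FluidPDE.timeDerivWithin (Ioo t₁ t₂) u s y, Φ (x₀ - y) • a⟫,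
    continuousOn_integral_inner_timeDerivWithin h hS hΨs.continuous hΨc,
    fun t ht => hasDerivAt_integral_inner_velocity h hS hΨs hΨc ht, fun t ht => ?_, fun t ht => ?_⟩
  · -- `|W| ≤ ε`
    obtain ⟨huc, hu3, huN, -, -⟩ := hdata t ht
    have hb := (hK₃ (u t) N huc hu3 hN0 huN R hR1 x₀).2
    calc |∫ y, ⟪u t y, Φ (x₀ - y) • a⟫| ≤ K₃ * (1 + N) * R⁻¹ := hb
      _ ≤ K * R⁻¹ := mul_le_mul_of_nonneg_right hK3le hRi
      _ ≤ ε := hKR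
  · -- `|g + W'| ≤ ε`
    obtain ⟨huc, hu3, huN, hQ, hQP⟩ := hdata t ht
    have b1 := hK₁ (u t) N huc hu3 hN0 huN R hR1 x₀
    have b2 := hK₂ (u t) N huc hu3 hN0 huN R hR1 x₀
    have b4 := hK₄ (rieszPressure (u t)) P hQ hP0 hQP R hR1 x₀
    have key := fderiv_mollified_harmonicPart_eq h hS ht (h3 t ht) φ hR0 x₀ a
    rw [key]
    dsimp only
    generalize (∫ y, ⟪u t y, (Δ (fun y => Φ (x₀ - y))) y • a⟫) = A at b1 ⊢
    generalize (∫ y, ⟪u t y, fderiv ℝ (fun y => Φ (x₀ - y)) y (u t y) • a⟫) = B at b2 ⊢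
    generalize (∫ y, fderiv ℝ Φ y a * rieszPressure (u t) (x₀ - y)) = D at b4 ⊢
    generalize (∫ y, ⟪FluidPDE.timeDerivWithin (Ioo t₁ t₂) u t y, Φ (x₀ - y) • a⟫) = C
    have e : ν * A + B - C - D + C = ν * A + B - D := by ring
    rw [e]
    calc |ν * A + B - D| ≤ ν * |A| + |B| + |D| := by
          calc |ν * A + B - D| ≤ |ν * A + B| + |D| := abs_sub _ _
            _ ≤ |ν * A| + |B| + |D| := by gcongr; exact abs_add_le _ _
            _ = ν * |A| + |B| + |D| := by rw [abs_mul, abs_of_nonneg hν]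
      _ ≤ ν * (K₁ * (1 + N) * R⁻¹) + K₂ * (1 + N) * R⁻¹ + K₄ * (1 + P) * R⁻¹ := by
          gcongr
      _ = ((ν * K₁ + K₂) * (1 + N) + K₄ * (1 + P)) * R⁻¹ := by ring
      _ ≤ K * R⁻¹ := mul_le_mul_of_nonneg_right hK124le hRi
      _ ≤ ε := hKR

/-- **Every mollification of the harmonic part is constant** (`θ` a normed bump of outer radius
`≤ 1`, `t ∈ (t₁, t₂)`). [cite: Tao2011, §4, proof of Lemma 4.1 (i)] -/
theorem mollified_harmonicPart_eq_const {t₁ t₂ : ℝ} (hν : 0 ≤ ν)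
    (h : IsClassicalNSSolutionOn (Ioo t₁ t₂) ν 0 u p)
    (h3 : ∀ t ∈ Ioo t₁ t₂, MemLp (u t) 3 volume) {M : ℝ≥0}
    (hM : ∀ t ∈ Ioo t₁ t₂, eLpNorm (u t) 3 volume ≤ M) (φ : ContDiffBump (0 : (EuclideanSpace ℝ (Fin 3))))
    (hφ : φ.rOut ≤ 1) {t : ℝ} (ht : t ∈ Ioo t₁ t₂) (x : (EuclideanSpace ℝ (Fin 3))) :
    (φ.normed volume ⋆ fun x => p t x - rieszPressure (u t) x) x =
      (φ.normed volume ⋆ fun x => p t x - rieszPressure (u t) x) 0 := by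
  have hcd : ContDiff ℝ 1 (φ.normed volume ⋆ fun x => p t x - rieszPressure (u t) x) :=
    (φ.hasCompactSupport_normed).contDiff_convolution_left _ φ.contDiff_normed
      (locallyIntegrable_harmonicPart h ht (h3 t ht))
  have hdiff : Differentiable ℝ (φ.normed volume ⋆ fun x => p t x - rieszPressure (u t) x) :=
    hcd.differentiable one_ne_zero
  refine is_const_of_fderiv_eq_zero hdiff (fun y => ?_) x 0
  ext a
  rw [fderiv_mollified_harmonicPart_eq_zero hν h h3 hM φ hφ y a t ht]
  rfl

/-- **Tao 2011, Lemma 4.1 (i), for `L³` slices (pressure normalisation).** Let `(u, p)` be a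
classical solution of the unforced Navier–Stokes system with viscosity `ν ≥ 0` on an open time
interval `(t₁, t₂)` (`IsClassicalNSSolutionOn (Ioo t₁ t₂) ν 0 u p`), with slices `u(t) ∈ L³(ℝ³)`
and `‖u(t)‖_{L³} ≤ M` for `t ∈ (t₁, t₂)`. Then for every `t ∈ (t₁, t₂)` there is a constant `C`
with `p(t, x) = Π[u(t)](x) + C` for a.e. `x`, where `Π[u(t)] ∈ L^{3/2}` is the Riesz pressure
`−Δ⁻¹∂ᵢ∂ⱼ(uᵢuⱼ)` (Tao: "`p = −Δ⁻¹∂ᵢ∂ⱼ(uᵢuⱼ) + C(t)`"; here without the finite-energy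
hypothesis, the argument being run in `L³ × L^{3/2}`). [cite: Tao2011, Lemma 4.1 (i) and its proof, §4] -/
theorem pressure_ae_eq_rieszPressure_add_const {t₁ t₂ : ℝ} (hν : 0 ≤ ν)
    (h : IsClassicalNSSolutionOn (Ioo t₁ t₂) ν 0 u p)
    (h3 : ∀ t ∈ Ioo t₁ t₂, MemLp (u t) 3 volume) {M : ℝ≥0}
    (hM : ∀ t ∈ Ioo t₁ t₂, eLpNorm (u t) 3 volume ≤ M) {t : ℝ} (ht : t ∈ Ioo t₁ t₂) :
    ∃ C : ℝ, ∀ᵐ x ∂(volume : Measure (EuclideanSpace ℝ (Fin 3))), p t x = rieszPressure (u t) x + C := by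
  obtain ⟨C, hC⟩ := ConvolutionLaplacian.ae_eq_const_of_forall_convolution_normed_const
    (locallyIntegrable_harmonicPart h ht (h3 t ht))
    (fun φ hφ => ⟨_, fun x => mollified_harmonicPart_eq_const hν h h3 hM φ hφ ht x⟩)
  refine ⟨C, hC.mono fun x hx => ?_⟩
  have hx' : p t x - rieszPressure (u t) x = C := hx
  linarith

end PressureNormalisationL3

end Literature.Analysis.FluidPDE

end
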